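import Summits.QuantumFields.YangMills.Theses.LangevinControlUV
import Literature.MathematicalPhysics.QuantumFieldTheory.MassGapFromLatticeClustering

/-!
# Strategy census — typed signatures (crux `GapToContinuum`, stmt-QuantumFields-8896)

Companion of `STRATEGY-CENSUS.md` (crux-strategist, wall-breaker pass, 2026-08-17).  Every
"strengthen" and "decomposition" attempt of the census is stated here as a Lean `Prop` with the
(trivial) implication to the typed crux kernel-checked, so that the census claim "every split
contains a piece equivalent to the crux" is about THESE signatures and not about prose.  The
negation normal form records exactly what a witness against the crux must supply.

Nothing here is proposed to the tree: the implications are logic; the content is the diagnosis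
in the `.md`.  `lean check`: rc 0, 0 sorries expected.
-/

noncomputable section

open scoped SchwartzMap
open MeasureTheory Filter Topology
open Literature.MathematicalPhysics.AQFT Literature.MathematicalPhysics.QuantumLattice
open Literature.MathematicalPhysics.QuantumFieldTheory

namespace Summit.QuantumFields.YangMills.Cruxes.GapToContinuum.StrategyCensus

open Summit.QuantumFields.YangMills.Theses.LangevinControlUV

/-! ## §S Strengthenings (each implies the crux; each inherits the dead lattice stub) -/

/-- **S⁺₁ — strengthened conclusion**: the typed hypotheses give BOTH the tree's norm-form lattice
clustering `sch.HasCSClustering r Δ` and the continuum gap.  Its first conjunct is verbatim the stub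
`stub_csClustering_of_{nonneg,neg}Beta` at which lines `Sketch`/`HeavyLemma` died (D1/D2/D3b). -/
def StrongCS : Prop :=
  ∀ (G : Type) [Group G] [TopologicalSpace G] [IsTopologicalGroup G] [CompactSpace G]
    [MeasurableSpace G] [BorelSpace G] (r : LatticeRep G) (sch : SpeciesScheme (YMSpecies G))
    (T : OSData (YMSpecies G) 4) (Δ : ℝ), 0 < Δ → IsYangMillsFor r sch T →
      HasLatticeMassGap r sch Δ → sch.HasCSClustering r Δ ∧ T.HasMassGap Δ

/-- S⁺₁ ⇒ crux (projection). -/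
theorem gapToContinuum_of_strongCS (h : StrongCS) : GapToContinuum :=
  fun G _ _ _ _ _ _ r sch T Δ hΔ hYM hlat => (h G r sch T Δ hΔ hYM hlat).2

/-- **S⁺₂ — `0 < Δ` dropped** (the disprover's §3c: `0 < Δ` is decoration; for `Δ ≤ 0` the
conclusion is the contraction bound of OS reconstruction).  More rigid in no useful sense: the
`Δ > 0` instances are the crux itself. -/
def StrongNoPos : Prop :=
  ∀ (G : Type) [Group G] [TopologicalSpace G] [IsTopologicalGroup G] [CompactSpace G]
    [MeasurableSpace G] [BorelSpace G] (r : LatticeRep G) (sch : SpeciesScheme (YMSpecies G))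
    (T : OSData (YMSpecies G) 4) (Δ : ℝ), IsYangMillsFor r sch T →
      HasLatticeMassGap r sch Δ → T.HasMassGap Δ

/-- S⁺₂ ⇒ crux. -/
theorem gapToContinuum_of_strongNoPos (h : StrongNoPos) : GapToContinuum :=
  fun G _ _ _ _ _ _ r sch T Δ _ hYM hlat => h G r sch T Δ hYM hlat

/-- **S⁺₃ — lattice hypothesis dropped** (= the disprover's `GapToContinuumWithoutLatticeGap`):
"every Wilson continuum limit along any scheme has every mass gap" — false in mathematics as soon as
one gapless/under-gapped Wilson continuum limit exists (free photon of compact `U(1)`), hence not a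
line; recorded to show the only induction/compactness-friendly strengthening is absurd. -/
def StrongNoLattice : Prop :=
  ∀ (G : Type) [Group G] [TopologicalSpace G] [IsTopologicalGroup G] [CompactSpace G]
    [MeasurableSpace G] [BorelSpace G] (r : LatticeRep G) (sch : SpeciesScheme (YMSpecies G))
    (T : OSData (YMSpecies G) 4) (Δ : ℝ), 0 < Δ → IsYangMillsFor r sch T → T.HasMassGap Δ

/-- S⁺₃ ⇒ crux. -/
theorem gapToContinuum_of_strongNoLattice (h : StrongNoLattice) : GapToContinuum :=
  fun G _ _ _ _ _ _ r sch T Δ hΔ hYM _ => h G r sch T Δ hΔ hYM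

/-! ## §D Decompositions (each glue kernel-checked; in each, one child is the whole crux) -/

/-- **D₁ child 1 — the lattice upgrade** (`HasLatticeMassGap ⇒ HasCSClustering` along an
`IsYangMillsFor` scheme): verbatim the dead stub; by lead a1's `gapToContinuum_iff_diagonalCore`
(p125787) and L1 its diagonal weakening is already EQUIVALENT to the crux. -/
def SubLatticeUpgrade : Prop :=
  ∀ (G : Type) [Group G] [TopologicalSpace G] [IsTopologicalGroup G] [CompactSpace G]
    [MeasurableSpace G] [BorelSpace G] (r : LatticeRep G) (sch : SpeciesScheme (YMSpecies G))
    (T : OSData (YMSpecies G) 4) (Δ : ℝ), 0 < Δ → IsYangMillsFor r sch T →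
      HasLatticeMassGap r sch Δ → sch.HasCSClustering r Δ

/-- D₁ glue: child 1 + the TREE theorem `IsYangMillsFor.hasMassGap_of_hasCSClustering` (child 2,
already proved = R1) ⇒ crux.  So the split isolates nothing: child 1 carries the whole crux. -/
theorem gapToContinuum_of_latticeUpgrade (h : SubLatticeUpgrade) : GapToContinuum :=
  fun G _ _ _ _ _ _ r sch T Δ hΔ hYM hlat =>
    hYM.hasMassGap_of_hasCSClustering (h G r sch T Δ hΔ hYM hlat)

/-- **D₂ — regime split, child W (weak coupling, the only case `closes` consumes).** -/
def SubWeak : Prop :=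
  ∀ (G : Type) [Group G] [TopologicalSpace G] [IsTopologicalGroup G] [CompactSpace G]
    [MeasurableSpace G] [BorelSpace G] (r : LatticeRep G) (sch : SpeciesScheme (YMSpecies G))
    (T : OSData (YMSpecies G) 4) (Δ : ℝ), 0 < Δ → sch.HasWeakCouplingLimit →
      IsYangMillsFor r sch T → HasLatticeMassGap r sch Δ → T.HasMassGap Δ

/-- **D₂ — regime split, child N (no weak-coupling limit: `β_k` bounded above frequently).** -/
def SubNonWeak : Prop :=
  ∀ (G : Type) [Group G] [TopologicalSpace G] [IsTopologicalGroup G] [CompactSpace G]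
    [MeasurableSpace G] [BorelSpace G] (r : LatticeRep G) (sch : SpeciesScheme (YMSpecies G))
    (T : OSData (YMSpecies G) 4) (Δ : ℝ), 0 < Δ → ¬ sch.HasWeakCouplingLimit →
      IsYangMillsFor r sch T → HasLatticeMassGap r sch Δ → T.HasMassGap Δ

/-- D₂ glue (excluded middle on `sch.HasWeakCouplingLimit`).  Both children keep the per-pair
threshold defect D2 and the own-torus defect D3b verbatim (they never mention `β`), so neither is
easier than the crux; child W is the shape of OneCertifiedCube's stmt-16126 minus its pair-uniform
`k₀`, which five leads and the sibling's ten leads grade "still misstated". -/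
theorem gapToContinuum_of_regimeSplit (hW : SubWeak) (hN : SubNonWeak) : GapToContinuum := by
  intro G _ _ _ _ _ _ r sch T Δ hΔ hYM hlat
  by_cases h : sch.HasWeakCouplingLimit
  · exact hW G r sch T Δ hΔ h hYM hlat
  · exact hN G r sch T Δ hΔ h hYM hlat

/-- The `(1,1)` sector of `HasMassGap` (one leg on each side; every species pair). -/
def OneLegGap {ι : Type} (T : OSData ι 4) (Δ : ℝ) : Prop :=
  ∀ (k k' : Fin 1 → ι) (F G : 𝓢((Fin 1 → EuclideanSpace ℝ (Fin 4)), ℂ)),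
    IsTimeOrdered F → IsTimeOrdered G →
      ∃ C : ℝ, ∀ t : ℝ, 0 ≤ t →
        ∀ H : 𝓢((Fin (1 + 1) → EuclideanSpace ℝ (Fin 4)), ℂ),
          IsAppendTensorOf H (osAdjoint F) (translateMulti (EuclideanSpace.single 0 t) G) →
            ‖T.schwinger (1 + 1) (Fin.append (k ∘ Fin.rev) k') H -
                T.schwinger 1 (k ∘ Fin.rev) (osAdjoint F) * T.schwinger 1 k' G‖ ≤
              C * Real.exp (-Δ * t)

/-- The full gap contains its `(1,1)` sector. -/
theorem oneLegGap_of_hasMassGap {ι : Type} (T : OSData ι 4) (Δ : ℝ) (h : T.HasMassGap Δ) :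
    OneLegGap T Δ :=
  fun k k' F G hF hG => h 1 1 k k' F G hF hG

/-- **D₃ — sector split, child 1: the one-leg sector of the crux** (ideators 1–2: "closes as typed"
via the translation-invariant heavy subspace; leads/triage: dead as typed too — D2 already enters ONE
smeared leg through the pairs `(O, O ∘ τ_z)`, `|z| ≲ diam(supp g)/a_k`, and D3b (thermal term on the
own time-periodic torus; `TriageThermalToy`, `TriageNormGapThermalToy`) needs the volume/renormalisation
growth clauses the typed `sch` does not carry). -/
def SubOneLeg : Prop :=
  ∀ (G : Type) [Group G] [TopologicalSpace G] [IsTopologicalGroup G] [CompactSpace G]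
    [MeasurableSpace G] [BorelSpace G] (r : LatticeRep G) (sch : SpeciesScheme (YMSpecies G))
    (T : OSData (YMSpecies G) 4) (Δ : ℝ), 0 < Δ → IsYangMillsFor r sch T →
      HasLatticeMassGap r sch Δ → OneLegGap T Δ

/-- **D₃ — sector split, child 2: multi-leg residual given the one-leg gap** (the landed
`Negative/HeavyProductLeak.lean`, p120725, is the abstract reason this child is the whole difficulty:
one-leg heavy kets are not product/sandwich closed). -/
def SubMultiLeg : Prop :=
  ∀ (G : Type) [Group G] [TopologicalSpace G] [IsTopologicalGroup G] [CompactSpace G]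
    [MeasurableSpace G] [BorelSpace G] (r : LatticeRep G) (sch : SpeciesScheme (YMSpecies G))
    (T : OSData (YMSpecies G) 4) (Δ : ℝ), 0 < Δ → IsYangMillsFor r sch T →
      HasLatticeMassGap r sch Δ → OneLegGap T Δ → T.HasMassGap Δ

/-- D₃ glue. -/
theorem gapToContinuum_of_sectorSplit (h₁ : SubOneLeg) (h₂ : SubMultiLeg) : GapToContinuum :=
  fun G _ _ _ _ _ _ r sch T Δ hΔ hYM hlat =>
    h₂ G r sch T Δ hΔ hYM hlat (h₁ G r sch T Δ hΔ hYM hlat)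

/-! ## §N Negation normal form: what a witness must supply -/

/-- **¬crux, unfolded.**  A refutation needs ONE compact (linear) group `G`, a faithful unitary `r`,
a scheme `sch` and OS data `T` that ARE the Wilson continuum limit along `sch` (`IsYangMillsFor`),
with per-pair lattice clustering at rate `Δ > 0` on all tori `S ≥ L_k` for all `n ≤ S`, and a
continuum truncated function decaying slower than `e^{-Δt}` for every constant.  Every Wilson model
evaluable today is ultralocal on `⁰𝒮` (conclusion holds with constant `0`); the Coulomb phase of
`U(1)` violates the lattice clause (`n` unbounded at fixed `k`); see `STRATEGY-CENSUS.md` §Negation. -/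
theorem not_gapToContinuum_iff :
    ¬ GapToContinuum ↔
      ∃ (G : Type) (_ : Group G) (_ : TopologicalSpace G) (_ : IsTopologicalGroup G)
        (_ : CompactSpace G) (_ : MeasurableSpace G) (_ : BorelSpace G) (r : LatticeRep G)
        (sch : SpeciesScheme (YMSpecies G)) (T : OSData (YMSpecies G) 4) (Δ : ℝ),
        0 < Δ ∧ IsYangMillsFor r sch T ∧ HasLatticeMassGap r sch Δ ∧ ¬ T.HasMassGap Δ := by
  constructor
  · intro h
    by_contra hne
    apply h
    intro G _ _ _ _ _ _ r sch T Δ hΔ hYM hlat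
    by_contra hgap
    exact hne ⟨G, _, _, _, _, _, _, r, sch, T, Δ, hΔ, hYM, hlat, hgap⟩
  · rintro ⟨G, _, _, _, _, _, _, r, sch, T, Δ, hΔ, hYM, hlat, hgap⟩ h
    exact hgap (h G r sch T Δ hΔ hYM hlat)

/-- **The disprover's load-bearing lemma, re-derived at the typed crux**: any refutation is in
particular a gapless Wilson continuum limit (`IsYangMillsFor ∧ ¬HasMassGap`), i.e. a witness against
the strengthening `StrongNoLattice` — the research-level object named in `Disproof.lean` §3. -/
theorem not_strongNoLattice_of_not_gapToContinuum (h : ¬ GapToContinuum) : ¬ StrongNoLattice :=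
  fun hs => h (gapToContinuum_of_strongNoLattice hs)

end Summit.QuantumFields.YangMills.Cruxes.GapToContinuum.StrategyCensus

end
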